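import Mathlib
import HarnessLib
import Summits.HubbardSuperconductivity.HubbardSuperconductivity.Theorems.KLProgrammeKLRegimeEngineV8DefsG14

/-!
# K3 ENGINE (stmt-HubbardSuperconductivity-20437 `KLRegimeEngineV17F2`), row (c): the in-class particle–hole slot `(Klam U)²·klEngGeo14.phGain (n′+1) ρ` BELOW RESOLUTION —
# kernel certificate for LOCATED «(c)-IN-PH-BELOW-RESOLUTION» (cell gate-hubbard-kl, seat hubbard-kl-k3c1-p1 g26; memo `HOME/hubbard-kl-k3c1-p1/g26/LOCATED-C-IN-PH-BELOW-RESOLUTION.md`)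

WHAT.  Two arithmetic facts about the registered geometry package `klEngGeo14` at ZERO particle–hole transfer (the diagonal `k′ = k` of the in-class pair-transfer array, where
`klTorusNorm L (k − k) = 0`):
* `klEngGeo14_phGain_zero_eq` — the exact value `klEngGeo14.phGain n 0 = 2·(2²⁸·min 1 (2²⁴·(4ⁿ)⁻¹) + 2⁵²·(2ⁿ)⁻¹ + klTSA·√klE0·(2ⁿ)⁻¹) + 2⁵²·klTS·(2ⁿ)⁻¹`
  (`klRelGain n 0 = 0`, `klTwoShellProfile n 0 = √klE0·2⁻ⁿ`, `phGainOf … n n 0 = min 1 (2²⁴·4⁻ⁿ)`; chain `G14 → G13 → G11 → G10 = G9 → G8 = G7 = G6 = G5`);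
* `klEngGeo14_phGain_zero_le` — for `24 ≤ n`: **`klEngGeo14.phGain n 0 ≤ (2⁵⁴ + 2⁶⁰·klTS)·(2ⁿ)⁻¹`** (`2²⁴·4⁻ⁿ ≤ 2⁻ⁿ` from `n ≥ 24`, `√klE0 ≤ 1/4`, `klTSA = 2⁶⁰·klTS`).
So the ph slot of row (c) at the diagonal DECAYS like `2⁻ⁿ` (no plateau below the resolution `ρ < Λₙ·2⁻²⁴`), which is what the located reading compares with the flat core
`2048·15367·M4²` of binder #8's `M4²×mass` rows.  Arithmetic over `rfl`-level field lemmas only; nothing here asserts (c), any row of 20437, K3, U₀, the window or superconductivity.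
0 kit · 0 lit.
-/

noncomputable section

namespace Summit.HubbardSuperconductivity.HubbardSuperconductivity.Theorems.EngineV8

set_option linter.dupNamespace false -- summit = problem name (single-conjunct summit), D-0017

open Real Summit.HubbardSuperconductivity.HubbardSuperconductivity.Theorems.KLRegimeSplit
open Summit.HubbardSuperconductivity.HubbardSuperconductivity.Theorems

/-- The model ph profile at zero transfer: `phGainOf 2²⁴ 2²⁴ 2²⁴ 2²⁴ 0 e₀ n n 0 = min 1 (2²⁴·(4ⁿ)⁻¹)`. -/
theorem phGainOf_zero_transfer (e₀ : ℝ) (n : ℕ) :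
    phGainOf (2 ^ 24) (2 ^ 24) (2 ^ 24) (2 ^ 24) 0 e₀ n n 0 = min 1 (2 ^ 24 * ((4 : ℝ) ^ n)⁻¹) := by
  unfold phGainOf
  simp
  exact min_comm _ _

/-- **Exact value of the in-class ph slot profile at zero transfer.** -/
theorem klEngGeo14_phGain_zero_eq (n : ℕ) :
    klEngGeo14.phGain n 0 =
      2 * (2 ^ 28 * min 1 (2 ^ 24 * ((4 : ℝ) ^ n)⁻¹) + 2 ^ 52 * ((2 : ℝ) ^ n)⁻¹ + klTSA * (Real.sqrt klE0 * ((2 : ℝ) ^ n)⁻¹)) + 2 ^ 52 * klTS * ((2 : ℝ) ^ n)⁻¹ := by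
  rw [klEngGeo14_phGain, klEngGeo13_phGain, klEngGeo11_phGain, klEngGeo10_phGain, klEngGeo9_phGain, klEngGeo8_phGain, klEngGeo7_phGain,
    klEngGeo6_phGain, klEngGeo5_phGain_apply, max_self, klRelGain_zero, phGainOf_zero_transfer]
  simp [klTwoShellProfile]

/-- **The in-class ph slot profile at zero transfer decays like `2⁻ⁿ`**: `klEngGeo14.phGain n 0 ≤ (2⁵⁴ + 2⁶⁰·klTS)·(2ⁿ)⁻¹` for `24 ≤ n`. -/
theorem klEngGeo14_phGain_zero_le {n : ℕ} (hn : 24 ≤ n) : klEngGeo14.phGain n 0 ≤ (2 ^ 54 + 2 ^ 60 * klTS) * ((2 : ℝ) ^ n)⁻¹ := by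
  rw [klEngGeo14_phGain_zero_eq, klTSA_eq]
  have h2 : (0 : ℝ) < (2 : ℝ) ^ n := by positivity
  have hts : 0 ≤ klTS := klTS_nonneg
  have hs : Real.sqrt klE0 ≤ 1 / 4 := sqrt_klE0_le_quarter
  have hs0 : 0 ≤ Real.sqrt klE0 := Real.sqrt_nonneg _
  -- `2²⁴·4⁻ⁿ ≤ 2⁻ⁿ` for `n ≥ 24`
  have hmin : min 1 (2 ^ 24 * ((4 : ℝ) ^ n)⁻¹) ≤ ((2 : ℝ) ^ n)⁻¹ := by
    refine (min_le_right _ _).trans ?_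
    have h4 : ((4 : ℝ) ^ n) = (2 : ℝ) ^ n * (2 : ℝ) ^ n := by
      rw [show (4 : ℝ) = 2 * 2 by norm_num, mul_pow]
    have h24 : (2 : ℝ) ^ 24 ≤ (2 : ℝ) ^ n := pow_le_pow_right₀ (by norm_num) hn
    rw [h4, mul_inv, ← mul_assoc]
    calc 2 ^ 24 * ((2 : ℝ) ^ n)⁻¹ * ((2 : ℝ) ^ n)⁻¹ ≤ 1 * ((2 : ℝ) ^ n)⁻¹ := by
          refine mul_le_mul_of_nonneg_right ?_ (by positivity)
          rw [mul_inv_le_iff₀ h2, one_mul]; exact h24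
      _ = ((2 : ℝ) ^ n)⁻¹ := one_mul _
  set x := ((2 : ℝ) ^ n)⁻¹ with hx
  have hx0 : 0 < x := by positivity
  have hA : 2 ^ 28 * min 1 (2 ^ 24 * ((4 : ℝ) ^ n)⁻¹) ≤ 2 ^ 28 * x := mul_le_mul_of_nonneg_left hmin (by norm_num)
  have hB : 2 ^ 60 * klTS * (Real.sqrt klE0 * x) ≤ 2 ^ 60 * klTS * (1 / 4 * x) :=
    mul_le_mul_of_nonneg_left (mul_le_mul_of_nonneg_right hs hx0.le) (by positivity)
  nlinarith [hA, hB, hx0, hts]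

end Summit.HubbardSuperconductivity.HubbardSuperconductivity.Theorems.EngineV8

end
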